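import Mathlib
import Summits.ValiantsHypothesis.ValiantsHypothesis.Theses.ProofCarryingSymmetry
import Summits.ValiantsHypothesis.ValiantsHypothesis.Theorems.ProofCarryingSymmetryAssembly
import Summits.ValiantsHypothesis.ValiantsHypothesis.Theorems.ProofCarryingSymmetryRestorationQPPiCircuitVpFamily

/-!
# Route ProofCarryingSymmetry — `RestorationQP` implies `PerInvarianceProvableQP` (T_per)

A cross-item consequence of the necessity of the provability stub (lead c2, crux `RestorationQP`,
line `registered`): the route's rank-5 crux `PerInvarianceProvableQP` (T_per: "a small circuit for the
permanent could prove its own symmetry" — IF `per ∈ VP_ℂ` THEN quasi-polynomial circuits for `per_n`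
with quasi-polynomial `P_c(ℂ)` proofs of the invariances under the ADJACENT transpositions) follows
from `RestorationQP`: the permanent family is diagonally invariant (`rename_smul_perPoly`), so
`RestorationQP ⇒ T′` (`invarianceProvableQP_of_restorationQP`, which proves the invariance identities
for ALL `σ ∈ S_n`) applies to it.  Everything proved, no named facts.
-/

-- single-problem summit: `Summit.ValiantsHypothesis.ValiantsHypothesis.…` is the namespace by design (D-0017)
set_option linter.dupNamespace false

namespace Summit.ValiantsHypothesis.ValiantsHypothesis.Theorems

open Literature.Computability.AlgebraicComplexity

/-- **`RestorationQP → PerInvarianceProvableQP`** (the route's T_per crux is implied by its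
RestorationQP crux): symmetry restoration at quasi-polynomial cost gives, for the diagonally
invariant permanent family (if it is in VP), quasi-polynomial Hrubeš–Tzameret circuits all of whose
invariance identities — in particular those of the adjacent transpositions `(k k+1)` — have
quasi-polynomial `P_c(ℂ)` proofs. [folklore] -/
theorem perInvarianceProvableQP_of_restorationQP :
    Summit.ValiantsHypothesis.ValiantsHypothesis.Theses.ProofCarryingSymmetry.RestorationQP →
    Summit.ValiantsHypothesis.ValiantsHypothesis.Theses.ProofCarryingSymmetry.PerInvarianceProvableQP := by
  intro hR hVP
  obtain ⟨c, hc⟩ := invarianceProvableQP_of_restorationQP hR (fun n => perPoly (Fin n) ℂ)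
    (fun n σ => Summit.ValiantsHypothesis.Theorems.ProofCarryingSymmetry.rename_smul_perPoly n σ) hVP
  refine ⟨c, fun n => ?_⟩
  obtain ⟨C, hev, hsize, hpc⟩ := hc n
  exact ⟨C, hev, hsize, fun k hk => hpc _⟩

end Summit.ValiantsHypothesis.ValiantsHypothesis.Theorems
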